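import Summits.BirchSwinnertonDyer.BirchSwinnertonDyer.Theorems.OneSidedTwistSqueezeX9KatoDivisibilityX9KolyvaginReciprocityPkValueInput
import Summits.BirchSwinnertonDyer.BirchSwinnertonDyer.Theorems.OneSidedTwistSqueezeX9KatoDivisibilityX9KolyvaginReciprocityPkCocycle
import Summits.BirchSwinnertonDyer.BirchSwinnertonDyer.Theorems.OneSidedTwistSqueezeX9KatoDivisibilityX9KolyvaginReciprocityPkDivision
import Literature.NumberTheory.EllipticCurves.KummerMap
import HarnessLib

set_option autoImplicit false

-- the summit and its single problem are both named `BirchSwinnertonDyer` (registry layout D-0017)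
set_option linter.dupNamespace false

/-!
# Crux `KatoDivisibilityX9` (stmt-BirchSwinnertonDyer-20547), line `graded_euler_loss`, stub
# `stub_reciprocityPkAX9` (hG34ᵍ), items (M1)+(M2) of `hKolyRecPk` ASSEMBLED: THE KOLYVAGIN PACKAGE AT LEVEL
# `p^{k+1}` — the Kolyvagin cocycle `c` of the genuine Euler system in `𝒯_L^{(k+1)}(E)`, `L = 2p^N(k+1)`, at an
# `E[p^{k+1}]`-split Kolyvagin prime `q` of depth `N`, with `τq`, `hgen`, `hx`, `hcq`, a local Frobenius `r`, and the
# VALUE `c(res τq) = V(S)·φ(res r)`, `V·ω_N ≡ 0 (mod p^{k+1}, X^L)`, `V ≡ U·X^{L − p^N} (mod p)`, `p ∤ U(0)`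

Seat `bsd-line-k6-p4` (prover-bsd-line-k6-p4-g5-0, wave-2 stub worker B).  THEOREMS ONLY (no definition, no named
fact, no `sorry`); nothing is asserted about any curve; `--supports stmt-BirchSwinnertonDyer-20547 --as helper`.
Level-`p^{k+1}` twin of koly's `TameClass.exists_kolyvaginPackage` (`…X9KolyvaginPackage`, the discharge of lur-b's
`hKoly` at `n = 0`).  Composition of: (M1) `exists_tameCocycle_valueInputPk` (the genuine tame cocycle `y'` at level
`L' = 2L` with its norm cocycle `ψ'(g) = (φ̃−1)²φ'(g)`), (M2) `exists_kolyvaginCocyclePk_value` with the projection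
`π = (· mod T^L) ∘ (m·Q)(S)` (`X^L = m·ω² + p^{k+1}h`, `φ̃ − 1 = (ω·Q)(S)`) and the `ω`-adic division
`castLE_aeval_eq_neg_aeval_castLE_of_key_relation`; the passage from the truncated level-`L'` cocycle to ANY cocycle `φ`
of `(I.redTowerPk (k+1) s)_L` is a coboundary `(γ^t − 1)b` of depth `≥ N`, killed by `V(S)`
(`…Transfer.aeval_shiftEnd_unipotentPow_sub_eq_zero`).

* `geomTorsion_pow_eq_zero_of_forall_apply_eq_of_commutator_le` — `E[p^j]^U = 0` for `U ⊇ [Γ_ℚ, Γ_ℚ]` (`p` odd, `E[p]`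
  irreducible), by induction on `j` along `P ↦ p^{j}P : E[p^{j+1}] → E[p]`;
* **`exists_kolyvaginPackagePk`** — the package (statement shape = x10 p469014 / koly `exists_kolyvaginPackage` at level
  `p^{k+1}`, value in the `V(S)`-form of `hKolyRecPk`).

WHAT REMAINS for `hKolyRecPk` (honest): the LOCAL half (item (M3)) — Poitou–Tate for `𝒯_L^{(k+1)}(E) × 𝒯_L^{(k+1)}(E)(κ⁻¹)
→ μ_{p^{k+1}}` and the level-`p^{k+1}` `q`-term identity giving `C_i(c(res τq), Ψ̃(res r)) = 0` for `i + ε < L`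
(port of koly's `LocalSplitPrime.convCoeff_eq_zero_of_transverse_of_unramified` to `ZMod (p^{k+1})` coefficients).

References: K. Kato, Astérisque 295 (2004) §13.1 (13.1.1), Ex. 13.3, §13.8 [Kato2004Asterisque]; K. Rubin, *Euler Systems*
(2000) §4.4–4.5; B. Mazur, K. Rubin, Mem. AMS 799 (2004) §5.3 [MazurRubin2004]; L. Washington, GTM 83, §7.2, §13.1–13.2
[Washington1997]; J.-P. Serre, Invent. Math. 15 (1972) §5 [Serre1972]; HOME/MEMO-es.md §15 STEPS 3–4.
-/

noncomputable section

open CategoryTheory Function Finset Polynomial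
open scoped NumberField Pointwise ContRepresentation
open Field IsDedekindDomain
open Literature.NumberTheory.GaloisRepresentations
open Literature.NumberTheory.GaloisRepresentations.IsNonarchimedeanLocalField
open Literature.NumberTheory.EllipticCurves
open Literature.NumberTheory.EllipticCurves.ZpExtension
open Literature.NumberTheory.EllipticCurves.Kato2004
open Literature.NumberTheory.EllipticCurves.Kato2004.EulerSystemValues
open Rat.HeightOneSpectrum
open WeierstrassCurve (geomPoints geomTorsion galoisRepTorsion)
open Summit.BirchSwinnertonDyer.Rank1Residual.GaloisImage
open Summit.BirchSwinnertonDyer.BirchSwinnertonDyer.Rank1Residual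
open Summit.BirchSwinnertonDyer.BirchSwinnertonDyer.Theorems.OneSidedTwistSqueezeX9KatoDivisibilityX9StubReciprocityPkX9Transfer
open Summit.BirchSwinnertonDyer.BirchSwinnertonDyer.Theorems.OneSidedTwistSqueezeX9KatoDivisibilityX9StubReciprocityPkX9Local
open Summit.BirchSwinnertonDyer.BirchSwinnertonDyer.Theorems.OneSidedTwistSqueezeX9KatoDivisibilityX9KolyvaginReciprocityPkShapiro
open Summit.BirchSwinnertonDyer.BirchSwinnertonDyer.Theorems.OneSidedTwistSqueezeX9KatoDivisibilityX9KolyvaginReciprocityPkValueInput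
open Summit.BirchSwinnertonDyer.BirchSwinnertonDyer.Theorems.OneSidedTwistSqueezeX9KatoDivisibilityX9KolyvaginReciprocityPkCocycle
open Summit.BirchSwinnertonDyer.BirchSwinnertonDyer.Theorems.OneSidedTwistSqueezeX9KatoDivisibilityX9KolyvaginReciprocityPkDivision

namespace Summit.BirchSwinnertonDyer.BirchSwinnertonDyer.Theorems.OneSidedTwistSqueezeX9KatoDivisibilityX9KolyvaginReciprocityPkPackage

/-! ## §1 `E[p^j]` has no non-zero vector fixed by `Gal(ℚ̄/ℚ(μ_ℓ))` -/

section Fixed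

variable (W : WeierstrassCurve ℚ) [W.IsElliptic] (p : ℕ) [Fact p.Prime]

/-- **`E[p^j]^U = 0` for `U ⊇ [Γ_ℚ, Γ_ℚ]`** (`p` odd, `E[p]` irreducible): by induction on `j`, a `U`-fixed point `m`
of `E[p^{j+1}]` has `p^j·m ∈ E[p]^U = 0` (x10 `TameSeams.torsionGaloisModule_eq_zero_of_forall_apply_eq_of_commutator_le`),
so `m ∈ E[p^j]^U = 0`. [cite: Serre1972, §5.2 (iv) and §5.4] -/
theorem geomTorsion_pow_eq_zero_of_forall_apply_eq_of_commutator_le (hp2 : p ≠ 2)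
    (hirr : W.HasIrreducibleModPGaloisRep p) {U : Subgroup (absoluteGaloisGroup ℚ)}
    (hU : commutator (absoluteGaloisGroup ℚ) ≤ U) :
    ∀ (j : ℕ) (m : geomTorsion W ((p : ℤ) ^ j)), (∀ g ∈ U, g • m = m) → m = 0 := by
  intro j
  induction j with
  | zero =>
    intro m _
    apply Subtype.ext
    have h := (WeierstrassCurve.mem_geomTorsion_iff W _ (m : geomPoints W)).mp m.2
    simp only [pow_zero, one_smul] at h
    simpa using h
  | succ j ih =>
    intro m hm
    -- `p^j • m ∈ E[p]` is fixed, hence `0`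
    have h1 : W.geomTorsionPowToModP p j m = 0 := by
      refine TameSeams.torsionGaloisModule_eq_zero_of_forall_apply_eq_of_commutator_le W p hp2 hirr hU _
        fun g hg => ?_
      rw [WeierstrassCurve.torsionGaloisModule_apply_apply, ← WeierstrassCurve.geomTorsionPowToModP_smul, hm g hg]
    -- so `m ∈ E[p^j]`, fixed, hence `0`
    have hmj : (m : geomPoints W) ∈ geomTorsion W ((p : ℤ) ^ j) := by
      rw [WeierstrassCurve.mem_geomTorsion_iff]
      have := congrArg (fun P : geomTorsion W (p : ℤ) => (P : geomPoints W)) h1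
      simpa only [WeierstrassCurve.coe_geomTorsionPowToModP, ZeroMemClass.coe_zero] using this
    have h2 := ih ⟨m, hmj⟩ fun g hg => Subtype.ext (by
      rw [AddSubgroup.torsionBy.coe_smul]
      have := congrArg (fun P : geomTorsion W ((p : ℤ) ^ (j + 1)) => (P : geomPoints W)) (hm g hg)
      simpa only [AddSubgroup.torsionBy.coe_smul] using this)
    exact Subtype.ext (by simpa using congrArg Subtype.val h2)

/-- `hfix` for `E[p^{k+1}]` and `N = Gal(ℚ̄/ℚ(μ_ℓ))` in the spelling of `exists_kolyvaginCocyclePk_value`.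
[cite: Serre1972, §5.2 (iv) and §5.4] -/
theorem torsionGaloisModule_pow_eq_zero_of_forall_rootsOfUnityFixer_apply_eq (hp2 : p ≠ 2)
    (hirr : W.HasIrreducibleModPGaloisRep p) (k ℓ : ℕ) [NeZero ℓ] :
    ∀ m : geomTorsion W ((p : ℤ) ^ (k + 1)),
      (∀ g ∈ rootsOfUnityFixer ℚ ℓ, W.torsionGaloisModule ((p : ℤ) ^ (k + 1)) g m = m) → m = 0 :=
  fun m hm => geomTorsion_pow_eq_zero_of_forall_apply_eq_of_commutator_le W p hp2 hirr
    (commutator_le_rootsOfUnityFixer ℚ ℓ) (k + 1) m fun g hg => by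
      rw [← WeierstrassCurve.torsionGaloisModule_apply_apply]; exact hm g hg

end Fixed

/-! ## §2 The Kolyvagin package at level `p^{k+1}` -/

section Package

variable (W : WeierstrassCurve ℚ) [W.IsElliptic] [W.IsGloballyMinimal] (p : ℕ) [Fact p.Prime] (k : ℕ)
  [ContinuousSMul ℤ_[p] (W.tateModule p)]
  [Module.Free ℤ_[p] (W.tateModule p)] [Module.Finite ℤ_[p] (W.tateModule p)]
  (κ : ZpExtension ℚ p) (γ : absoluteGaloisGroup ℚ) (I : IwasawaH1Data W p κ γ)

-- heartbeat head-room for the long statement and context; own budget line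
set_option maxHeartbeats 800000 in
/-- **THE KOLYVAGIN PACKAGE AT LEVEL `p^{k+1}` (items (M1)+(M2) of `hKolyRecPk`).**  For a genuine Λ-adic
Euler-system class `s` (`p` odd, `E[p]` irreducible) there is a finite `S₀` such that for every depth `N`
(`e' + 1 = p^N`), the level `L = J + 1 = 2p^N(k+1)`, every cocycle `φ` of `(I.redTowerPk (k+1) s)_L`, every `q ∉ S₀`
(prime `ℓ`) and every `E[p^{k+1}]`-split arithmetic Frobenius `Fr` at `𝔓 ∣ q` of depth exactly `N`: there are a global
cocycle `c` of `𝒯_L^{(k+1)}(E)` (the Kolyvagin cocycle), `τq ∈ I_{ℚ_q}` whose mod-`ℓ` cyclotomic character generates, a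
local arithmetic Frobenius `r`, with `loc_w [c]` unramified for `w ≠ q`, `w ∤ p`, `E[p^{k+1}]` unramified at `w`,
`loc_q [c]` transverse, and polynomials `V, U ∈ ℤ[X]` with `p ∤ U(0)`, `V·((X+1)^{p^N} − 1) ≡ 0 (mod p^{k+1}, X^L)`,
`V ≡ U·X^{L − p^N} (mod p)`, and the VALUE `c(res τq) = V(S)·φ(res r)`.
[cite: Kato2004Asterisque, §13.1 (13.1.1), Ex. 13.3 and §13.8] [cite: MazurRubin2004, §5.3]
[cite: Washington1997, §7.2 and §13.1–§13.2] -/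
theorem exists_kolyvaginPackagePk (hp2 : p ≠ 2) (hirr : W.HasIrreducibleModPGaloisRep p) {s : I.H}
    (hES : IsEulerSystemClass W p κ γ I s) :
    ∃ S₀ : Set (HeightOneSpectrum (𝓞 ℚ)), S₀.Finite ∧
      ∀ (N e' : ℕ), e' + 1 = p ^ N →
      ∀ (J : ℕ), J + 1 = (2 * e' + 1 + 1) * (k + 1) →
      ∀ (φ : contOneCocycles (κ.twistModPk (W.torsionGaloisModule ((p : ℤ) ^ (k + 1)))
          (W.pow_nsmul_geomTorsion_eq_zero p (k + 1)) (J + 1)).toTopRep),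
        oneCocycleClass _ φ = (I.redTowerPk (k + 1) s : ∀ J : ℕ, galoisCohomology (κ.twistModPk
          (W.torsionGaloisModule ((p : ℤ) ^ (k + 1))) (W.pow_nsmul_geomTorsion_eq_zero p (k + 1)) J) 1) (J + 1) →
      ∀ (q : HeightOneSpectrum (𝓞 ℚ)), q ∉ S₀ →
      ∀ [NeZero ((primesEquiv q : Nat.Primes) : ℕ)] [Fact (((primesEquiv q : Nat.Primes) : ℕ)).Prime]
        [NeZero ((((primesEquiv q : Nat.Primes) : ℕ) : ℕ) : q.adicCompletion ℚ)]
        [(rootsOfUnityFixer ℚ ((primesEquiv q : Nat.Primes) : ℕ)).Normal]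
        [Fintype (absoluteGaloisGroup ℚ ⧸ rootsOfUnityFixer ℚ ((primesEquiv q : Nat.Primes) : ℕ))],
      ∀ 𝔓 ∈ q.primesAbove, ∀ (Fr : absoluteGaloisGroup ℚ), IsArithFrobAt (𝓞 ℚ) Fr 𝔓 →
        galoisRepTorsion W ((p : ℤ) ^ (k + 1)) Fr = 1 → Fr ∈ κ.layerSubgroup N → Fr ∉ κ.layerSubgroup (N + 1) →
      ∃ (c : contOneCocycles (κ.twistModPk (W.torsionGaloisModule ((p : ℤ) ^ (k + 1)))
          (W.pow_nsmul_geomTorsion_eq_zero p (k + 1)) (J + 1)).toTopRep)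
        (τq r : absoluteGaloisGroup (q.adicCompletion ℚ)),
        τq ∈ absInertia (q.adicCompletion ℚ) ∧
        (∀ u : (ZMod ((primesEquiv q : Nat.Primes) : ℕ))ˣ,
          u ∈ Subgroup.zpowers (modPCyclotomicCharacterZMod (q.adicCompletion ℚ)
            ((primesEquiv q : Nat.Primes) : ℕ) τq)) ∧
        (∀ w : HeightOneSpectrum (𝓞 ℚ), w ≠ q → (p : 𝓞 ℚ) ∉ w.asIdeal →
          GaloisRep.IsUnramifiedAt w (W.torsionGaloisModule ((p : ℤ) ^ (k + 1))) →
          galoisCohomology.localization (κ.twistModPk (W.torsionGaloisModule ((p : ℤ) ^ (k + 1)))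
              (W.pow_nsmul_geomTorsion_eq_zero p (k + 1)) (J + 1)) (Sum.inr w) 1 (oneCocycleClass _ c) ∈
            DiscreteGaloisModule.unramifiedSubgroup (GaloisRep.toLocal w (κ.twistModPk
              (W.torsionGaloisModule ((p : ℤ) ^ (k + 1))) (W.pow_nsmul_geomTorsion_eq_zero p (k + 1)) (J + 1))) 1) ∧
        galoisCohomology.localization (κ.twistModPk (W.torsionGaloisModule ((p : ℤ) ^ (k + 1)))
            (W.pow_nsmul_geomTorsion_eq_zero p (k + 1)) (J + 1)) (Sum.inr q) 1 (oneCocycleClass _ c) ∈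
          DiscreteGaloisModule.transverseSubgroup (GaloisRep.toLocal q (κ.twistModPk
            (W.torsionGaloisModule ((p : ℤ) ^ (k + 1))) (W.pow_nsmul_geomTorsion_eq_zero p (k + 1)) (J + 1)))
            (CyclotomicField ((primesEquiv q : Nat.Primes) : ℕ) (q.adicCompletion ℚ)) ∧
        IsAbsArithFrob r ∧
        ∃ V U : ℤ[X], ¬ ((p : ℤ) ∣ U.coeff 0) ∧
          (∀ i : ℕ, i < J + 1 → (p : ℤ) ^ (k + 1) ∣ (V * ((X + 1 : ℤ[X]) ^ (e' + 1) - 1)).coeff i) ∧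
          (∀ i : ℕ, i < J + 1 → (p : ℤ) ∣ (V - U * X ^ (J + 1 - (e' + 1))).coeff i) ∧
          c.1 (absGaloisRestrict ℚ (q.adicCompletion ℚ) τq) =
            aeval (shiftEnd (geomTorsion W ((p : ℤ) ^ (k + 1))) (J + 1)) V
              (φ.1 (absGaloisRestrict ℚ (q.adicCompletion ℚ) r)) := by
  classical
  have hp : p.Prime := Fact.out
  obtain ⟨S₀, hS₀, hmain⟩ := exists_tameCocycle_valueInputPk W p k κ γ I hES
  refine ⟨S₀, hS₀, ?_⟩
  intro N e' he' J hJ φ hφ q hq _ _ _ _ _ 𝔓 h𝔓 Fr hFr hsplit hFrN hFrN'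
  have hL : J + 1 = 2 * p ^ N * (k + 1) := by rw [hJ, ← he']; ring
  have hMk : ∀ x : geomTorsion W ((p : ℤ) ^ (k + 1)), p ^ (k + 1) • x = 0 :=
    W.pow_nsmul_geomTorsion_eq_zero p (k + 1)
  -- (M1) the value input at level `L' = L + L`
  obtain ⟨hqp, hunr, hdvd, u, y', hu, hact, hyI', hrel⟩ :=
    hmain q hq h𝔓 hFr hsplit hFrN hFrN' (J + 1 + (J + 1))
  -- the ring identity `X^L = m ω² + p^{k+1} h`, the cofactor `Q`, `φ̃ − 1 = (ωQ)(S)`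
  obtain ⟨m, h, hmrel⟩ := exists_omega_sq_rel hp N k
  obtain ⟨hωQ, -⟩ := omega_mul_geom_sum (p ^ N) u
  have hmrel' : m * ((X + 1 : ℤ[X]) ^ p ^ N - 1) ^ 2 + ((p ^ (k + 1) : ℕ) : ℤ[X]) * h = X ^ (J + 1) := by
    rw [Nat.cast_pow, hL]; exact hmrel
  have hU1 : unipotentPow (geomTorsion W ((p : ℤ) ^ (k + 1))) (J + 1 + (J + 1)) (p ^ N * u) - 1 =
      aeval (shiftEnd (geomTorsion W ((p : ℤ) ^ (k + 1))) (J + 1 + (J + 1)))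
        (((X + 1 : ℤ[X]) ^ p ^ N - 1) * ∑ j ∈ range u, ((X + 1 : ℤ[X]) ^ p ^ N) ^ j) := by
    rw [OneSidedTwistSqueezeX9KatoDivisibilityX9StubReciprocityPkX9Transfer.unipotentPow_eq_aeval,
      show (X + 1 : ℤ[X]) ^ (p ^ N * u) =
      ((X + 1 : ℤ[X]) ^ p ^ N - 1) * (∑ j ∈ range u, ((X + 1 : ℤ[X]) ^ p ^ N) ^ j) + 1 by
        rw [hωQ, sub_add_cancel], map_add, map_one, add_sub_cancel_right]
  -- a cocycle of the level-`L'` class and its norm cocycle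
  obtain ⟨φ', hφ'⟩ := oneCocycleClass_surjective _ ((I.redTowerPk (k + 1) s : ∀ J : ℕ, galoisCohomology
    (κ.twistModPk (W.torsionGaloisModule ((p : ℤ) ^ (k + 1))) (W.pow_nsmul_geomTorsion_eq_zero p (k + 1)) J) 1)
    (J + 1 + (J + 1)))
  obtain ⟨ψ', hψ', hnorm⟩ := hrel φ' hφ'
  -- the projection `π = (· mod T^L) ∘ (mQ)(S)`
  obtain ⟨fmQ, hfmQ⟩ := exists_contIntertwiningMap_aeval_shiftEnd κ (W.torsionGaloisModule ((p : ℤ) ^ (k + 1)))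
    (W.pow_nsmul_geomTorsion_eq_zero p (k + 1)) (J + 1 + (J + 1))
    (m * ∑ j ∈ range u, ((X + 1 : ℤ[X]) ^ p ^ N) ^ j)
  have hπ : ∀ x, ((κ.twistModPkTruncate (W.torsionGaloisModule ((p : ℤ) ^ (k + 1)))
      (W.pow_nsmul_geomTorsion_eq_zero p (k + 1)) (J + 1 + (J + 1)) (Nat.le_add_right _ _)).comp fmQ) x =
      fun i => aeval (shiftEnd (geomTorsion W ((p : ℤ) ^ (k + 1))) (J + 1 + (J + 1)))
        (m * ∑ j ∈ range u, ((X + 1 : ℤ[X]) ^ p ^ N) ^ j) x (Fin.castLE (Nat.le_add_right _ _) i) := by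
    intro x
    funext i
    rw [← hfmQ x]
    rfl
  -- `π` kills `ψ'`
  have hψJ : ∀ g, ((κ.twistModPkTruncate (W.torsionGaloisModule ((p : ℤ) ^ (k + 1)))
      (W.pow_nsmul_geomTorsion_eq_zero p (k + 1)) (J + 1 + (J + 1)) (Nat.le_add_right _ _)).comp fmQ) (ψ'.1 g) = 0 := by
    intro g
    rw [hπ, hψ' g, hU1]
    exact castLE_aeval_sub_one_sq_apply_eq_zero hMk hmrel' (Nat.le_add_right _ _) _ (φ'.1 g)
  -- (M2) the Kolyvagin cocycle
  obtain ⟨σ, -, τq, hτq, -, hgen, -, c, hx, hcq, r, hr, -, a', hval, hkey⟩ :=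
    exists_kolyvaginCocyclePk_value κ (W.torsionGaloisModule ((p : ℤ) ^ (k + 1)))
      (W.pow_nsmul_geomTorsion_eq_zero p (k + 1)) (J + 1) hp2 q
      (torsionGaloisModule_pow_eq_zero_of_forall_rootsOfUnityFixer_apply_eq W p hp2 hirr k _) hqp hunr hdvd
      _ y' hyI' ψ' hnorm hψJ
  refine ⟨c, τq, r, hτq, hgen, hx, hcq, hr,
    m * ((X + 1 : ℤ[X]) ^ p ^ N - 1) * (∑ j ∈ range u, ((X + 1 : ℤ[X]) ^ p ^ N) ^ j) ^ 2,
    (∑ j ∈ range u, ((X + 1 : ℤ[X]) ^ p ^ N) ^ j) ^ 2,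
    not_prime_dvd_coeff_zero_geom_sum_sq p N u hu, fun i hi => ?_, fun i hi => ?_, ?_⟩
  · rw [he']
    exact prime_pow_dvd_coeff_valuePoly_mul_omega hmrel _ i (by rw [← hL]; exact hi)
  · have hsub : J + 1 - (e' + 1) = 2 * p ^ N * (k + 1) - p ^ N := by rw [he', hL]
    rw [hsub]
    exact prime_dvd_coeff_valuePoly_sub hmrel _ i
  · -- the value: the key relation divided by `ω`
    have hkey' : aeval (shiftEnd (geomTorsion W ((p : ℤ) ^ (k + 1))) (J + 1 + (J + 1)))
          (((X + 1 : ℤ[X]) ^ p ^ N - 1) * ∑ j ∈ range u, ((X + 1 : ℤ[X]) ^ p ^ N) ^ j) a' =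
        -(aeval (shiftEnd (geomTorsion W ((p : ℤ) ^ (k + 1))) (J + 1 + (J + 1)))
            (((X + 1 : ℤ[X]) ^ p ^ N - 1) * ∑ j ∈ range u, ((X + 1 : ℤ[X]) ^ p ^ N) ^ j)
          (aeval (shiftEnd (geomTorsion W ((p : ℤ) ^ (k + 1))) (J + 1 + (J + 1)))
            (((X + 1 : ℤ[X]) ^ p ^ N - 1) * ∑ j ∈ range u, ((X + 1 : ℤ[X]) ^ p ^ N) ^ j)
            (φ'.1 (absGaloisRestrict ℚ (q.adicCompletion ℚ) r)))) := by
      have h1 := hkey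
      rw [hact r hr a', hψ' (absGaloisRestrict ℚ (q.adicCompletion ℚ) r), hU1] at h1
      rw [← h1, ← hU1, LinearMap.sub_apply, Module.End.one_apply]
    have hdiv := castLE_aeval_eq_neg_aeval_castLE_of_key_relation hMk hmrel' (le_refl (J + 1 + (J + 1))) _ a'
      (φ'.1 (absGaloisRestrict ℚ (q.adicCompletion ℚ) r)) hkey'
    rw [hval, hπ, hdiv, neg_neg]
    -- the truncated cocycle and `φ` differ by a coboundary killed by `V(S)`
    have hcl : oneCocycleClass _ (contOneCocycles.pullback (ContinuousMonoidHom.id (absoluteGaloisGroup ℚ))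
        (X := (κ.twistModPk (W.torsionGaloisModule ((p : ℤ) ^ (k + 1)))
          (W.pow_nsmul_geomTorsion_eq_zero p (k + 1)) (J + 1 + (J + 1))).toTopRep)
        (Y := (κ.twistModPk (W.torsionGaloisModule ((p : ℤ) ^ (k + 1)))
          (W.pow_nsmul_geomTorsion_eq_zero p (k + 1)) (J + 1)).toTopRep)
        (TopRep.ofHom ⟨(κ.twistModPkTruncate (W.torsionGaloisModule ((p : ℤ) ^ (k + 1)))
          (W.pow_nsmul_geomTorsion_eq_zero p (k + 1)) (J + 1 + (J + 1)) (Nat.le_add_right _ _)).toContinuousLinearMap,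
          (κ.twistModPkTruncate (W.torsionGaloisModule ((p : ℤ) ^ (k + 1)))
          (W.pow_nsmul_geomTorsion_eq_zero p (k + 1)) (J + 1 + (J + 1)) (Nat.le_add_right _ _)).isIntertwining'⟩) φ') =
        oneCocycleClass _ φ := by
      rw [← galoisCohomology.map_oneCocycleClass_ofHom, hφ', hφ]
      exact ZpExtension.truncH1Pk_apply_coe κ _ _ (I.redTowerPk (k + 1) s) (Nat.le_add_right _ _)
    obtain ⟨b, hb⟩ := exists_coboundary_of_oneCocycleClass_eq _ hcl
    have hb' : (fun i : Fin (J + 1) => φ'.1 (absGaloisRestrict ℚ (q.adicCompletion ℚ) r)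
        (Fin.castLE (Nat.le_add_right _ _) i)) =
        φ.1 (absGaloisRestrict ℚ (q.adicCompletion ℚ) r) +
          (κ.twistModPk (W.torsionGaloisModule ((p : ℤ) ^ (k + 1))) (W.pow_nsmul_geomTorsion_eq_zero p (k + 1))
            (J + 1) (absGaloisRestrict ℚ (q.adicCompletion ℚ) r) b - b) :=
      hb (absGaloisRestrict ℚ (q.adicCompletion ℚ) r)
    -- `res r` is `E[p^{k+1}]`-split of depth `≥ N`: `(res r)·b − b = ((1+S)^t − 1) b`, `p^N ∣ t`
    obtain ⟨hρr, hrN, -⟩ := StepsTwoFourTransport.isSplit_and_depth_absGaloisRestrict_of_isArithFrobAt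
      (W.torsionGaloisModule ((p : ℤ) ^ (k + 1))) κ hunr hqp h𝔓 hFr
      (torsionGaloisModule_eq_one_of_galoisRepTorsion_eq_one W hsplit) hFrN hFrN' hr
    have hcob : κ.twistModPk (W.torsionGaloisModule ((p : ℤ) ^ (k + 1))) (W.pow_nsmul_geomTorsion_eq_zero p (k + 1))
        (J + 1) (absGaloisRestrict ℚ (q.adicCompletion ℚ) r) b =
        unipotentPow (geomTorsion W ((p : ℤ) ^ (k + 1))) (J + 1)
          (κ.twistExponent (J + 1 + (k + 1)) (absGaloisRestrict ℚ (q.adicCompletion ℚ) r)) b := by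
      rw [twistModPk_apply]
      congr 1
      funext i
      rw [hρr]
      rfl
    have hNle : N ≤ J + 1 + (k + 1) := by
      have h1 := Nat.lt_pow_self hp.one_lt (n := N)
      have h2 : p ^ N ≤ 2 * p ^ N := Nat.le_mul_of_pos_left _ two_pos
      have h3 : 2 * p ^ N ≤ 2 * p ^ N * (k + 1) := Nat.le_mul_of_pos_right _ (Nat.succ_pos k)
      omega
    have ht : p ^ N ∣ κ.twistExponent (J + 1 + (k + 1)) (absGaloisRestrict ℚ (q.adicCompletion ℚ) r) :=
      κ.prime_pow_dvd_twistExponent hNle hrN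
    have hVω : ∀ i, i < J + 1 → ((p ^ (k + 1) : ℕ) : ℤ) ∣
        (m * ((X + 1 : ℤ[X]) ^ p ^ N - 1) * (∑ j ∈ range u, ((X + 1 : ℤ[X]) ^ p ^ N) ^ j) ^ 2 *
          ((X + 1 : ℤ[X]) ^ p ^ N - 1)).coeff i := fun i hi => by
      rw [Nat.cast_pow]
      exact prime_pow_dvd_coeff_valuePoly_mul_omega hmrel _ i (by rw [← hL]; exact hi)
    rw [hb', map_add, hcob, aeval_shiftEnd_unipotentPow_sub_eq_zero hMk _ hVω ht b, add_zero]

end Package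

end Summit.BirchSwinnertonDyer.BirchSwinnertonDyer.Theorems.OneSidedTwistSqueezeX9KatoDivisibilityX9KolyvaginReciprocityPkPackage

end
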